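import Literature.NumberTheory.QuadraticFields.GenusCharacterValues
import Literature.NumberTheory.LFunctions.RayClassOrbitSums
import HarnessLib

/-!
# Genus theory of imaginary quadratic fields, II: the genus characters `ψ_p` of the class group

Topic `NumberTheory/QuadraticFields`, namespace `Literature.NumberTheory.QuadraticFields.Quadratic`
(continuing `GenusCharacterValues.lean`).  Everything here is PROVED (two definitions with bodies,
theorems; no named facts).

Let `K` be an imaginary quadratic field and `p` an ODD prime dividing `d_K`.  Gauss's **genus
character** `ψ_p : Cl_K → {±1}`, `ψ_p([𝔞]) = (N𝔞 / p)` for integral `𝔞` of norm prime to `p`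
(Cox, *Primes of the form x² + ny²*, §3.B Thm. 3.15, read on ideals through Thm. 7.7), is here
constructed as a group homomorphism `ψ_p : Cl_K →* ℂˣ` — a REAL class group character:

* `genusCharValue p c ∈ ℤ` — `(N𝔟 / p)` for a chosen integral `𝔟 ∈ c` coprime to `(p)` (the tree's
  `exists_isCoprime_mk0_eq`, Neukirch VI (1.9)); `genusCharValue_eq` — it equals `(N𝔞 / p)` for EVERY
  nonzero integral `𝔞 ∈ c` of norm prime to `p` (`legendreSym_absNorm_eq_of_mk0_eq`);
* `genusCharValue_one`, `genusCharValue_mul`, `genusCharValue_eq_one_or` — `ψ_p(1) = 1`,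
  multiplicativity (products of representatives), values `±1`;
* `genusChar hK hp hpd : ClassGroup (𝓞 K) →* ℂˣ` with `genusChar_apply_coe`
  (`(ψ_p(c) : ℂ) = genusCharValue p c`) and `genusChar_mul_self : ψ_p² = 1`;
* `genusChar_mk0_eq` — `ψ_p([𝔞]) = (N𝔞/p)` for `p ∤ N𝔞`; in particular for a prime `𝔮` of `K` over a
  rational prime `q ≠ p`: `ψ_p([𝔮]) = (N𝔮 / p)` (`= (q/p)` if `q` splits or ramifies, `= 1` if inert).

Non-triviality of `ψ_p` (existence of a class with `ψ_p = −1`, i.e. of genera) and the product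
relation between the `ψ_p` over all `p ∣ d_K` are the "existence" half of genus theory (Cox
Thm. 3.15 with Dirichlet's theorem) and are NOT in this file.

## References

* [Cox2013] D. A. Cox, *Primes of the form x² + ny²*, 2nd ed. (2013), §3.B Lemma 3.13, Thm. 3.15;
  §7.B Thm. 7.7.
* [NeukirchANT1999] J. Neukirch, *Algebraic Number Theory*, VI (1.9) (representatives prime to `𝔪`).
-/

noncomputable section

open scoped nonZeroDivisors NumberField
open Module NumberField
open Literature.NumberTheory.EllipticCurves
open Literature.NumberTheory.LFunctions (exists_isCoprime_mk0_eq)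

namespace Literature.NumberTheory.QuadraticFields.Quadratic

variable {K : Type*} [Field K] [NumberField K]

/-! ### Representatives prime to `(p)` -/

/-- `(p) ≠ 0` in `𝓞 K` for a prime `p`. [folklore] -/
theorem span_natCast_ne_bot {p : ℕ} (hp : p.Prime) : Ideal.span {(p : 𝓞 K)} ≠ ⊥ := by
  rw [Ne, Ideal.span_singleton_eq_bot]
  exact_mod_cast hp.ne_zero

/-- A chosen integral representative of the class `c`, coprime to `(p)`. [folklore] -/
def coprimeRep (p : ℕ) [Fact p.Prime] (c : ClassGroup (𝓞 K)) : Ideal (𝓞 K) :=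
  Classical.choose (exists_isCoprime_mk0_eq (span_natCast_ne_bot (K := K) (Fact.out : p.Prime)) c)

/-- The defining properties of `coprimeRep p c`: nonzero, coprime to `(p)`, of class `c`. [folklore] -/
theorem coprimeRep_spec (p : ℕ) [Fact p.Prime] (c : ClassGroup (𝓞 K)) :
    ∃ h : coprimeRep p c ≠ ⊥, IsCoprime (coprimeRep (K := K) p c) (Ideal.span {(p : 𝓞 K)}) ∧
      ClassGroup.mk0 ⟨coprimeRep p c, mem_nonZeroDivisors_iff_ne_zero.mpr h⟩ = c :=
  Classical.choose_spec (exists_isCoprime_mk0_eq (span_natCast_ne_bot (K := K) (Fact.out : p.Prime)) c)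

/-- **The value of the genus character**: `ψ_p(c) = (N𝔟 / p)` for the chosen representative `𝔟 ∈ c`
coprime to `(p)`. [cite: Cox2013, §3.B Thm. 3.15] -/
def genusCharValue (p : ℕ) [Fact p.Prime] (c : ClassGroup (𝓞 K)) : ℤ :=
  legendreSym p (Ideal.absNorm (coprimeRep p c))

/-- **`ψ_p(c) = (N𝔞 / p)` for every nonzero integral `𝔞 ∈ c` of norm prime to `p`** (`K` imaginary
quadratic, `p` an odd prime dividing `d_K`). [cite: Cox2013, §3.B Thm. 3.15] -/
theorem genusCharValue_eq (hK : IsImaginaryQuadratic K) {p : ℕ} [Fact p.Prime] (hp2 : p ≠ 2)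
    (hpd : (p : ℤ) ∣ NumberField.discr K) {I : Ideal (𝓞 K)} (hI : I ∈ (Ideal (𝓞 K))⁰)
    (hpI : ¬ (p : ℤ) ∣ Ideal.absNorm I) :
    genusCharValue p (ClassGroup.mk0 ⟨I, hI⟩) = legendreSym p (Ideal.absNorm I) := by
  obtain ⟨h0, hcop, hcls⟩ := coprimeRep_spec (K := K) p (ClassGroup.mk0 ⟨I, hI⟩)
  rw [genusCharValue]
  exact legendreSym_absNorm_eq_of_mk0_eq hK hp2 hpd _ hI hcls
    (not_dvd_absNorm_of_isCoprime hK.1 (Fact.out : p.Prime) hcop) hpI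

/-- `ψ_p(1) = 1`. [folklore] -/
theorem genusCharValue_one (hK : IsImaginaryQuadratic K) {p : ℕ} [Fact p.Prime] (hp2 : p ≠ 2)
    (hpd : (p : ℤ) ∣ NumberField.discr K) : genusCharValue (K := K) p 1 = 1 := by
  have hp : p.Prime := Fact.out
  have hN : Ideal.absNorm (((1 : (Ideal (𝓞 K))⁰) : Ideal (𝓞 K))) = 1 := by
    rw [OneMemClass.coe_one, map_one]
  have hnd : ¬ (p : ℤ) ∣ Ideal.absNorm (((1 : (Ideal (𝓞 K))⁰) : Ideal (𝓞 K))) := by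
    rw [hN, Nat.cast_one]
    intro h
    have := Int.le_of_dvd one_pos h
    have := hp.two_le
    omega
  have h := genusCharValue_eq hK hp2 hpd (1 : (Ideal (𝓞 K))⁰).2 hnd
  have e : (⟨((1 : (Ideal (𝓞 K))⁰) : Ideal (𝓞 K)), (1 : (Ideal (𝓞 K))⁰).2⟩ : (Ideal (𝓞 K))⁰) = 1 :=
    Subtype.ext rfl
  rw [e, map_one] at h
  rw [h, hN, Nat.cast_one, legendreSym.at_one]

/-- **Multiplicativity**: `ψ_p(c₁ c₂) = ψ_p(c₁) ψ_p(c₂)` (representatives coprime to `(p)` multiply to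
a representative coprime to `(p)`; norms and Legendre symbols are multiplicative). [cite: Cox2013, §3.B Thm. 3.15] -/
theorem genusCharValue_mul (hK : IsImaginaryQuadratic K) {p : ℕ} [Fact p.Prime] (hp2 : p ≠ 2)
    (hpd : (p : ℤ) ∣ NumberField.discr K) (c₁ c₂ : ClassGroup (𝓞 K)) :
    genusCharValue p (c₁ * c₂) = genusCharValue p c₁ * genusCharValue (K := K) p c₂ := by
  obtain ⟨h₁, hcop₁, hcls₁⟩ := coprimeRep_spec (K := K) p c₁
  obtain ⟨h₂, hcop₂, hcls₂⟩ := coprimeRep_spec (K := K) p c₂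
  set I₁ := coprimeRep (K := K) p c₁
  set I₂ := coprimeRep (K := K) p c₂
  have hp : (p : ℕ).Prime := Fact.out
  have h12 : I₁ * I₂ ≠ ⊥ := mul_ne_zero h₁ h₂
  have hcop : IsCoprime (I₁ * I₂) (Ideal.span {(p : 𝓞 K)}) := hcop₁.mul_left hcop₂
  have hcls : ClassGroup.mk0 ⟨I₁ * I₂, mem_nonZeroDivisors_iff_ne_zero.mpr h12⟩ = c₁ * c₂ := by
    rw [← hcls₁, ← hcls₂, ← map_mul]; rfl
  have hn₁ := not_dvd_absNorm_of_isCoprime hK.1 hp hcop₁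
  have hn₂ := not_dvd_absNorm_of_isCoprime hK.1 hp hcop₂
  have hn := not_dvd_absNorm_of_isCoprime hK.1 hp hcop
  rw [← hcls, genusCharValue_eq hK hp2 hpd _ hn, map_mul, Nat.cast_mul, legendreSym.mul]
  rfl

/-- `ψ_p(c) ∈ {1, −1}`. [folklore] -/
theorem genusCharValue_eq_one_or (hK : IsImaginaryQuadratic K) {p : ℕ} [Fact p.Prime]
    (c : ClassGroup (𝓞 K)) : genusCharValue (K := K) p c = 1 ∨ genusCharValue (K := K) p c = -1 := by
  obtain ⟨h0, hcop, -⟩ := coprimeRep_spec (K := K) p c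
  have hn := not_dvd_absNorm_of_isCoprime hK.1 (Fact.out : p.Prime) hcop
  refine legendreSym.eq_one_or_neg_one p (fun h ↦ hn ((ZMod.intCast_zmod_eq_zero_iff_dvd _ p).mp ?_))
  exact_mod_cast h

/-! ### The genus character as a class group character -/

/-- **The genus character `ψ_p : Cl_K →* ℂˣ`** of an imaginary quadratic field at an odd prime
`p ∣ d_K` (Gauss; Cox Thm. 3.15 / Thm. 7.7): `ψ_p([𝔞]) = (N𝔞 / p)`. [cite: Cox2013, §3.B Thm. 3.15] -/
def genusChar (hK : IsImaginaryQuadratic K) {p : ℕ} [Fact p.Prime] (hp2 : p ≠ 2)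
    (hpd : (p : ℤ) ∣ NumberField.discr K) : ClassGroup (𝓞 K) →* ℂˣ where
  toFun c := if genusCharValue p c = 1 then 1 else -1
  map_one' := by rw [if_pos (genusCharValue_one hK hp2 hpd)]
  map_mul' c₁ c₂ := by
    have hm := genusCharValue_mul hK hp2 hpd c₁ c₂
    rcases genusCharValue_eq_one_or hK (p := p) c₁ with h₁ | h₁ <;>
      rcases genusCharValue_eq_one_or hK (p := p) c₂ with h₂ | h₂ <;>
        simp [h₁, h₂, hm]

/-- `(ψ_p(c) : ℂ) = genusCharValue p c`. [folklore] -/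
theorem genusChar_apply_coe (hK : IsImaginaryQuadratic K) {p : ℕ} [Fact p.Prime] (hp2 : p ≠ 2)
    (hpd : (p : ℤ) ∣ NumberField.discr K) (c : ClassGroup (𝓞 K)) :
    ((genusChar hK hp2 hpd c : ℂˣ) : ℂ) = (genusCharValue p c : ℂ) := by
  show (((if genusCharValue p c = 1 then 1 else -1 : ℂˣ)) : ℂ) = _
  rcases genusCharValue_eq_one_or hK (p := p) c with h | h
  · rw [if_pos h, h]; simp
  · rw [if_neg (by rw [h]; norm_num), h]; simp

/-- **`ψ_p` is a real character**: `ψ_p² = 1`. [folklore] -/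
theorem genusChar_mul_self (hK : IsImaginaryQuadratic K) {p : ℕ} [Fact p.Prime] (hp2 : p ≠ 2)
    (hpd : (p : ℤ) ∣ NumberField.discr K) : genusChar hK hp2 hpd * genusChar hK hp2 hpd = 1 := by
  refine MonoidHom.ext fun c ↦ Units.val_injective ?_
  rw [MonoidHom.mul_apply, Units.val_mul, genusChar_apply_coe, MonoidHom.one_apply, Units.val_one]
  rcases genusCharValue_eq_one_or hK (p := p) c with h | h <;> rw [h] <;> norm_num

/-- **`ψ_p([𝔞]) = (N𝔞 / p)`** for a nonzero integral ideal of norm prime to `p`. [cite: Cox2013, §3.B Thm. 3.15] -/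
theorem genusChar_mk0_eq (hK : IsImaginaryQuadratic K) {p : ℕ} [Fact p.Prime] (hp2 : p ≠ 2)
    (hpd : (p : ℤ) ∣ NumberField.discr K) {I : Ideal (𝓞 K)} (hI : I ∈ (Ideal (𝓞 K))⁰)
    (hpI : ¬ (p : ℤ) ∣ Ideal.absNorm I) :
    ((genusChar hK hp2 hpd (ClassGroup.mk0 ⟨I, hI⟩) : ℂˣ) : ℂ) = (legendreSym p (Ideal.absNorm I) : ℂ) := by
  rw [genusChar_apply_coe, genusCharValue_eq hK hp2 hpd hI hpI]

end Literature.NumberTheory.QuadraticFields.Quadratic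

end
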